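import Summits.Ventures.Crystal3D.Theorems.StickyWulffConstantStackingLiminfRungSmoothMass
import Summits.Ventures.Crystal3D.Theorems.StickyWulffConstantStackingLiminfPlateauProfile
import HarnessLib

/-!
# The single-site kernel `κ_p = smooth (fun _ : Fin 1 => p) K L` of line `LayerChain` v4 (crux
# `StackingLiminf`, stmt-Ventures-19145): linearity, mass, height, support

Route `StickyWulffConstant` of the venture `Summits/Ventures/Crystal3D` (cell `crystal3d-full`).
The doubly mollified density is a sum of translates of ONE kernel, `κ_p(y) = ∫ η_L(ζ) φ_K(y − ιζ − p) dζ`,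
which in the tree's vocabulary is `smooth` of the one-point configuration at `p`:
* `smooth_eq_sum_single` — `smooth x K L y = Σ_i smooth (fun _ => x i) K L y`;
* `integral_smooth_single` — `∫ κ_p = 1/√2` (wulff-p2's R7 `rung_integral_smooth` at `N = 1`);
* `smooth_single_le` — the HEIGHT bound `κ_p ≤ 16·bumpConst/(π L² K)` (`η_L ≤ 4/(πL²)`, `φ_K ≤ c_K`
  on a lateral square of side `2K`, zero outside);
* `smooth_single_eq_zero_of_height` / `_of_lateral` — `κ_p(y) = 0` unless `|y₂ − p₂| < K` and
  `|y₀ − p₀|, |y₁ − p₁| < K + L`.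
These are the kernel facts of the bad-mass step of stub (C) `stub_plateauBound` (eng g6 architecture,
HOME/STATUS 2026-08-27T08:28Z): a ball whose kernel meets the sub-plateau set forces `≍ θ L² K` vacant
lattice sites nearby.
WHAT THIS IS NOT: not stub (C); rung F-C1 not moved.
-/

noncomputable section

namespace Summit.Ventures.Crystal3D.Theorems.PlateauHeight

open MeasureTheory Set Metric
open Summit.Ventures.Crystal3D.Cruxes.StackingLiminf.LayerChainV4 (bump bumpConst dens eta smooth)
open Summit.Ventures.Crystal3D.LayerChain (dot3)

/-- The lateral kernel has compact support (`L > 0`). -/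
theorem hasCompactSupport_eta {L : ℝ} (hL : 0 < L) : HasCompactSupport (eta L) := by
  refine HasCompactSupport.intro (isCompact_closedBall (0 : ℝ × ℝ) L) fun z hz => ?_
  rw [mem_closedBall, dist_zero_right, not_le, Prod.norm_def, lt_max_iff] at hz
  refine eta_eq_zero_of_coord hL ?_
  rcases hz with h | h
  · exact Or.inl (by rw [← Real.norm_eq_abs]; exact h.le)
  · exact Or.inr (by rw [← Real.norm_eq_abs]; exact h.le)

/-- `ζ ↦ η_L(ζ) · g(ζ)` is integrable for continuous `g` (`L > 0`). -/
theorem integrable_eta_mul {L : ℝ} (hL : 0 < L) {g : ℝ × ℝ → ℝ} (hg : Continuous g) :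
    Integrable fun z => eta L z * g z :=
  ((continuous_eta L).mul hg).integrable_of_hasCompactSupport ((hasCompactSupport_eta hL).mul_right)

/-- The lateral kernel is bounded by `4/(π L²)`. -/
theorem eta_le (L : ℝ) (z : ℝ × ℝ) : eta L z ≤ 4 / (Real.pi * L ^ 2) := by
  unfold eta
  have h1 : (max 0 (1 - (z.1 ^ 2 + z.2 ^ 2) / L ^ 2)) ^ 3 ≤ 1 := by
    have hle : max 0 (1 - (z.1 ^ 2 + z.2 ^ 2) / L ^ 2) ≤ 1 :=
      max_le zero_le_one (by linarith [div_nonneg (by positivity : 0 ≤ z.1 ^ 2 + z.2 ^ 2) (sq_nonneg L)])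
    calc (max 0 (1 - (z.1 ^ 2 + z.2 ^ 2) / L ^ 2)) ^ 3 ≤ 1 ^ 3 :=
        pow_le_pow_left₀ (le_max_left _ _) hle 3
      _ = 1 := one_pow 3
  have h0 : 0 ≤ 4 / (Real.pi * L ^ 2) := by positivity
  calc 4 / (Real.pi * L ^ 2) * (max 0 (1 - (z.1 ^ 2 + z.2 ^ 2) / L ^ 2)) ^ 3
      ≤ 4 / (Real.pi * L ^ 2) * 1 := mul_le_mul_of_nonneg_left h1 h0
    _ = _ := mul_one _

/-- The bump is bounded by `c_K = bumpConst/K³`. -/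
theorem bump_le {K : ℝ} (hK : 0 < K) (u : Fin 3 → ℝ) : bump K u ≤ bumpConst / K ^ 3 := by
  rw [bump_eq_profile hK]
  have h0 : 0 ≤ bumpConst / K ^ 3 := div_nonneg bumpConst_pos.le (pow_nonneg hK.le 3)
  calc bumpConst / K ^ 3 * (max 0 (1 - (max 0 (Real.sqrt (dot3 u u) / K)) ^ 2)) ^ 3
      ≤ bumpConst / K ^ 3 * 1 := mul_le_mul_of_nonneg_left (profile_le_one _) h0
    _ = _ := mul_one _

/-- The one-point density is the translated bump. -/
theorem dens_single (p : EuclideanSpace ℝ (Fin 3)) (K : ℝ) (y : Fin 3 → ℝ) :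
    dens (fun _ : Fin 1 => p) K y = bump K (fun j => y j - p j) := by
  unfold dens
  simp

/-- **Linearity: the doubly mollified density is the sum of the one-point kernels.** -/
theorem smooth_eq_sum_single {N : ℕ} (x : Fin N → EuclideanSpace ℝ (Fin 3)) {K L : ℝ}
    (hL : 0 < L) (y : Fin 3 → ℝ) :
    smooth x K L y = ∑ i, smooth (fun _ : Fin 1 => x i) K L y := by
  unfold smooth
  simp_rw [dens_single]
  rw [← integral_finsetSum]
  · refine integral_congr_ae (ae_of_all _ fun z => ?_)
    simp only [dens, Finset.mul_sum]
  · intro i _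
    refine integrable_eta_mul hL ((continuous_bump K).comp ?_)
    exact continuous_pi fun j => by fin_cases j <;> simp <;> fun_prop

/-- **Mass of the kernel**: `∫ κ_p = 1/√2`. -/
theorem integral_smooth_single (p : EuclideanSpace ℝ (Fin 3)) {K L : ℝ} (hK : 0 < K) (hL : 0 < L) :
    ∫ y, smooth (fun _ : Fin 1 => p) K L y = 1 / Real.sqrt 2 := by
  rw [rung_integral_smooth 1 (fun _ : Fin 1 => p) K L hK hL]
  simp

/-- **Height of the kernel**: `κ_p(y) ≤ 16·bumpConst/(π L² K)`. -/
theorem smooth_single_le (p : EuclideanSpace ℝ (Fin 3)) {K L : ℝ} (hK : 0 < K) (hL : 0 < L)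
    (y : Fin 3 → ℝ) :
    smooth (fun _ : Fin 1 => p) K L y ≤ 16 * bumpConst / (Real.pi * L ^ 2 * K) := by
  unfold smooth
  simp_rw [dens_single]
  -- the lateral square where the translated bump can be nonzero
  set S : Set (ℝ × ℝ) := Icc (y 0 - p 0 - K) (y 0 - p 0 + K) ×ˢ Icc (y 1 - p 1 - K) (y 1 - p 1 + K)
    with hS
  have hSm : MeasurableSet S := measurableSet_Icc.prod measurableSet_Icc
  have hSvol : (volume S).toReal = (2 * K) * (2 * K) := by
    rw [hS, Measure.volume_eq_prod, Measure.prod_prod, Real.volume_Icc, Real.volume_Icc,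
      ENNReal.toReal_mul, ENNReal.toReal_ofReal (by linarith), ENNReal.toReal_ofReal (by linarith)]
    ring
  have hc : 0 ≤ bumpConst / K ^ 3 := div_nonneg bumpConst_pos.le (pow_nonneg hK.le 3)
  have hpt : ∀ z : ℝ × ℝ, eta L z * bump K (fun j => y j - (![z.1, z.2, 0] : Fin 3 → ℝ) j - p j) ≤
      S.indicator (fun _ => 4 / (Real.pi * L ^ 2) * (bumpConst / K ^ 3)) z := by
    intro z
    by_cases hz : z ∈ S
    · rw [indicator_of_mem hz]
      exact mul_le_mul (eta_le L z) (bump_le hK _) (bump_nonneg hK _) (by positivity)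
    · rw [indicator_of_notMem hz]
      -- outside the square one of the two lateral coordinates of the bump argument is `≥ K`
      rw [hS, Set.mem_prod, mem_Icc, mem_Icc, not_and_or] at hz
      have hzero : bump K (fun j => y j - (![z.1, z.2, 0] : Fin 3 → ℝ) j - p j) = 0 := by
        rcases hz with h | h
        · refine bump_eq_zero_of_coord hK 0 ?_
          simp only [Matrix.cons_val_zero]
          rw [not_and_or, not_le, not_le] at h
          rcases h with h | h
          · rw [abs_of_nonneg (by linarith)]; linarith
          · rw [abs_of_nonpos (by linarith)]; linarith
        · refine bump_eq_zero_of_coord hK 1 ?_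
          simp only [Matrix.cons_val_one, Matrix.cons_val_zero]
          rw [not_and_or, not_le, not_le] at h
          rcases h with h | h
          · rw [abs_of_nonneg (by linarith)]; linarith
          · rw [abs_of_nonpos (by linarith)]; linarith
      rw [hzero, mul_zero]
  have hint : Integrable fun z : ℝ × ℝ =>
      eta L z * bump K (fun j => y j - (![z.1, z.2, 0] : Fin 3 → ℝ) j - p j) := by
    refine integrable_eta_mul hL ((continuous_bump K).comp ?_)
    exact continuous_pi fun j => by fin_cases j <;> simp <;> fun_prop
  have hind : Integrable fun z : ℝ × ℝ =>
      S.indicator (fun _ => 4 / (Real.pi * L ^ 2) * (bumpConst / K ^ 3)) z := by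
    refine (integrable_indicator_iff hSm).2 ((integrableOn_const_iff).2 (Or.inr ?_))
    rw [hS, Measure.volume_eq_prod, Measure.prod_prod]
    exact ENNReal.mul_lt_top measure_Icc_lt_top measure_Icc_lt_top
  calc ∫ z : ℝ × ℝ, eta L z * bump K (fun j => y j - (![z.1, z.2, 0] : Fin 3 → ℝ) j - p j)
      ≤ ∫ z : ℝ × ℝ, S.indicator (fun _ => 4 / (Real.pi * L ^ 2) * (bumpConst / K ^ 3)) z :=
        integral_mono hint hind hpt
    _ = (volume S).toReal * (4 / (Real.pi * L ^ 2) * (bumpConst / K ^ 3)) := by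
        rw [integral_indicator_const _ hSm, smul_eq_mul, measureReal_def]
    _ = 16 * bumpConst / (Real.pi * L ^ 2 * K) := by
        rw [hSvol]; field_simp; ring

/-- **Vertical support of the kernel**: `κ_p(y) = 0` if `|y₂ − p₂| ≥ K`. -/
theorem smooth_single_eq_zero_of_height (p : EuclideanSpace ℝ (Fin 3)) {K : ℝ} (hK : 0 < K) (L : ℝ)
    {y : Fin 3 → ℝ} (hy : K ≤ |y 2 - p 2|) : smooth (fun _ : Fin 1 => p) K L y = 0 := by
  unfold smooth
  simp_rw [dens_single]
  refine integral_eq_zero_of_ae (Filter.Eventually.of_forall fun z => ?_)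
  simp only [Pi.zero_apply]
  rw [bump_eq_zero_of_coord hK 2 (by simpa using hy), mul_zero]

/-- **Lateral support of the kernel**: `κ_p(y) = 0` if `|y₀ − p₀| ≥ K + L` or `|y₁ − p₁| ≥ K + L`. -/
theorem smooth_single_eq_zero_of_lateral (p : EuclideanSpace ℝ (Fin 3)) {K L : ℝ} (hK : 0 < K)
    (hL : 0 < L) {y : Fin 3 → ℝ} (hy : K + L ≤ |y 0 - p 0| ∨ K + L ≤ |y 1 - p 1|) :
    smooth (fun _ : Fin 1 => p) K L y = 0 := by
  unfold smooth
  simp_rw [dens_single]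
  refine integral_eq_zero_of_ae (Filter.Eventually.of_forall fun z => ?_)
  simp only [Pi.zero_apply]
  by_cases hz : L ≤ |z.1| ∨ L ≤ |z.2|
  · rw [eta_eq_zero_of_coord hL hz, zero_mul]
  · rw [not_or, not_le, not_le] at hz
    rcases hy with h | h
    · rw [bump_eq_zero_of_coord hK 0 ?_, mul_zero]
      simp only [Matrix.cons_val_zero]
      have := abs_sub_abs_le_abs_sub (y 0 - p 0) z.1
      have e : y 0 - p 0 - z.1 = y 0 - z.1 - p 0 := by ring
      rw [e] at this
      linarith [hz.1]
    · rw [bump_eq_zero_of_coord hK 1 ?_, mul_zero]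
      simp only [Matrix.cons_val_one, Matrix.cons_val_zero]
      have := abs_sub_abs_le_abs_sub (y 1 - p 1) z.2
      have e : y 1 - p 1 - z.2 = y 1 - z.2 - p 1 := by ring
      rw [e] at this
      linarith [hz.2]

end Summit.Ventures.Crystal3D.Theorems.PlateauHeight

end
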